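import Summits.QuantumFields.BalabanUV.T4Continuum.Support.NE7EffectiveFormLowerBoundClass
import HarnessLib

/-!
# NE7EffectiveFormLowerBoundFinal — (G′) AT d = 4 WITH THE ε-LINES PACKAGED: given the auxiliary slice-Poincaré parameters `(τ, ε_c)` satisfying row NE3's four K-road lines, THERE IS
# `ε₀ > 0` such that (G′) holds for every class radius `0 < ε < ε₀`, every `N ≥ 1` and every level `j` (lineage `b2b-balaban-t4-ne7-p1`, gen 119, file H17)

Cell `pub-balaban`, rung (B)+1 sub-cell t4, CRUX PROVER NE7 #1 (OWNER of row NE7), generation 119.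
WHY.  ✓ H16 `NE7EffectiveFormLowerBoundClass.effectiveForm_lower_bound_class` is (G′) with every hypothesis a numeric line; seventeen of them are smallness lines LINEAR (or monotone) in the
class radius `ε` with positive thresholds depending only on `(L, card n, τ, ε_c)`.  THIS FILE removes them: each holds for all small `ε > 0` (`eventually_nhdsGT_mul_le`; the exponential
line through `|e^x − 1| ≤ 2|x|`), so the right-neighbourhood basis of `0` yields one `ε₀ > 0`.  What stays displayed is exactly what is NOT about `ε`: `0 < τ`, `0 < ε_c` and the four K-road
lines of row NE3's class slice Poincaré inequality in `(τ, ε_c)` (row NE3 exhibited admissible values at `L = 2`, SU(2): `NE3ClassRadiusFamily` §4).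
WHAT ([folklore]; 0 def, 0 sorry; d = 4): **`eventually_nhdsGT_mul_le'`**, **`effectiveForm_lower_bound_final`**.
HONEST FRAMING (page 1): (G′) is row NE7's binder target about OUR lattice objects in the lineage's all-data frame («∃ δV ∀ V₀ δV-small»); NOT Bałaban's NE7 as printed, NOT a spine
node by itself (spine 0∕9 until the NE7 record consumes it); nothing of Bałaban's asserted; finite T⁴ rung (B)+1 — NOT continuum YM on ℝ⁴, NOT infinite volume, NOT mass gap, NOT
BetaPertH, NOT Clay.
-/

set_option autoImplicit false

open scoped BigOperators Matrix Matrix.Norms.L2Operator Topology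
open NormedSpace Finset Set Filter Metric

namespace Summit.QuantumFields.BalabanUV.T4Continuum.NE7EffectiveFormLowerBoundFinal

open Literature.MathematicalPhysics.QuantumFieldTheory.Balaban1983to89
open B7Prop1Explicit B7Prop2Explicit MatrixLog UnitaryModel
open T4AveragingDeficitWall (IsUnitaryCfg IsSkewDir SmallField Ad curl curlAt curlSq dirSq dirL1 fineAction)
open T4AveragingDeficitWallBoundary (IsPeriodicCfg periodBox)
open AveragingDeficitTorusChart (TDir chart chartDir resDir extDir)
open AveragingDeficitTwoLevelPrep (twoLevelSmall skewSub skewPR)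
open AveragingDeficitMultiLevelPrep (cavgIter tower levelQ levelQ' LevelSmall tower_ne_zero)
open MatrixNorms (nhsNormSq)
open MinimalActionLevels (perWin stepWt)
open MinimalActionSandwich (IsMinimiser minAct)
open MinimalActionRate (sfClass)
open NE7RadIterUniform (radD)
open NE7StraightTowerCurlEnergy (eC mC)
open NE3QbarIterCovLiftPrep (cruxC)
open NE3RightInverseSolveLetters (thetaLoc)
open NE7SliceRepHessianFloor (liftMassC liftCurlC)
open NE3HatInvCurlLetters (curl1C)
open BlockAverageVaryHolo (nbRad)
open NE3CovariantLineSumsError (Csup)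
open NE3CovariantLineSumsL2 (C2sq)
open NE3CovariantLineSumsL2Tower (rho)
open ShellMeasureAverageProp4General (C1cov)
open NE3SlicePoincareBudgetLine (ShLine SmallYLine CPLine)
open NE7StrippedMultiplierLetterL1 (eventually_nhdsGT_mul_le)
open NE7EffectiveFormLowerBoundClass (effectiveForm_lower_bound_class)

noncomputable section

variable {n : Type} [Fintype n] [DecidableEq n]

omit [Fintype n] [DecidableEq n] in
/-- For ANY real `A` and `c > 0`, `t·A ≤ c` for all small `t > 0`. [folklore] -/
theorem eventually_nhdsGT_mul_le' (A : ℝ) {c : ℝ} (hc : 0 < c) : ∀ᶠ t in 𝓝[>] (0 : ℝ), t * A ≤ c := by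
  filter_upwards [eventually_nhdsGT_mul_le (le_max_right A 0) hc, self_mem_nhdsWithin] with t ht ht0
  exact le_trans (mul_le_mul_of_nonneg_left (le_max_left A 0) (le_of_lt ht0)) ht

/-- **(G′) AT d = 4, ε-LINES PACKAGED INTO ONE `ε₀ > 0`** (see the module docstring; `C_P := CPLine 4 L (card n) ε_c τ`, `C_Λ(ε) := 2·curl1C·ε·(128·C₁L²·4(4L+1)⁴·L²)`). [folklore] -/
theorem effectiveForm_lower_bound_final [Nonempty n] {L : ℕ} [NeZero L] (hL : 2 ≤ L) {τ εc : ℝ} (hτ : 0 < τ) (hεc : 0 < εc)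
    (h1 : ShLine 4 L (Fintype.card n) εc τ ≤ 1 / 2) (h2 : SmallYLine 4 L (Fintype.card n) εc τ ≤ 1 / 2)
    (h3 : 68 / 3 * ((((4 : ℕ) : ℝ) + 1) * (((4 : ℕ) : ℝ) + 4)) * C2sq 4 L * τ ≤ rho 4 L / 2)
    (h4 : 8 * ((4 : ℕ) : ℝ) * ((((4 : ℕ) : ℝ) - 1) * τ) ^ 2
        + 2 * ((Fintype.card n : ℝ) * ((4 * ((4 : ℕ) : ℝ) ^ 2 + 272 * ((4 : ℕ) : ℝ) * ((((4 : ℕ) : ℝ) + 1) * (((4 : ℕ) : ℝ) + 4))) * τ) ^ 2) ≤ 1 / 2) :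
    ∃ ε₀ : ℝ, 0 < ε₀ ∧ ∀ ε : ℝ, 0 < ε → ε < ε₀ →
      ∀ (N : ℕ) [NeZero N], 1 ≤ N → ∀ j : ℕ,
      ∃ δV : ℝ, 0 < δV ∧
        ∀ V₀ ∈ {V : Site 4 → Fin 4 → (Matrix n n ℂ)ˣ | IsUnitaryCfg V ∧ IsPeriodicCfg V (N : ℤ) ∧ SmallField V δV},
        ∀ Us : Site 4 → Fin 4 → (Matrix n n ℂ)ˣ, IsMinimiser 4 (sfClass 4 L N ε) L N (j + 1) V₀ Us → ∀ θ : ℝ, 0 < θ →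
        ∀ v : ↥(skewSub 4 n N),
          (1 - (2 * curl1C 4 L * ε * (128 * (C1cov 4 * (L : ℝ) ^ 2 * (4 * (4 * (L : ℝ) + 1) ^ 4)) * (L : ℝ) ^ 2)) * (2 * (4 * CPLine 4 L (Fintype.card n) εc τ * Fintype.card n)))
              * (((stepWt 4 L)⁻¹) ^ (j + 1) * ∑ P ∈ perWin 4 N, nhsNormSq (curl V₀ (chartDir (ContinuousLinearMap.id ℝ (Matrix n n ℂ)) N (v : TDir 4 n N)) P))
            ≤ ((1 + θ) + 2 * ((1 + θ) * (14 * (Fintype.card (T4AveragingDeficitWall.Plane 4) : ℝ) * ε) + (1 + θ⁻¹) * (36 * eC 4 L (Fintype.card n) ^ 2 * ε ^ 2))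
                    * (4 * CPLine 4 L (Fintype.card n) εc τ * Fintype.card n))
                * fderiv ℝ (fderiv ℝ (fun y : ↥(skewSub 4 n N) => minAct 4 (sfClass 4 L N ε) L N (j + 1) (chart (ContinuousLinearMap.id ℝ (Matrix n n ℂ)) N V₀ (y : TDir 4 n N)))) 0 v v
              + ((stepWt 4 L)⁻¹) ^ (j + 1)
                * (2 * (((1 + θ) + 2 * ((1 + θ) * (14 * (Fintype.card (T4AveragingDeficitWall.Plane 4) : ℝ) * ε) + (1 + θ⁻¹) * (36 * eC 4 L (Fintype.card n) ^ 2 * ε ^ 2))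
                        * (4 * CPLine 4 L (Fintype.card n) εc τ * Fintype.card n)))
                      * (2 * curl1C 4 L * ε * (128 * (C1cov 4 * (L : ℝ) ^ 2 * (4 * (4 * (L : ℝ) + 1) ^ 4)) * (L : ℝ) ^ 2)) * (2 * liftMassC 4 L + 4 * CPLine 4 L (Fintype.card n) εc τ * liftCurlC 4 L)
                    + (1 - (2 * curl1C 4 L * ε * (128 * (C1cov 4 * (L : ℝ) ^ 2 * (4 * (4 * (L : ℝ) + 1) ^ 4)) * (L : ℝ) ^ 2)) * (2 * (4 * CPLine 4 L (Fintype.card n) εc τ * Fintype.card n)))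
                      * (2 * ((1 + θ) * (14 * (Fintype.card (T4AveragingDeficitWall.Plane 4) : ℝ) * ε) + (1 + θ⁻¹) * (36 * eC 4 L (Fintype.card n) ^ 2 * ε ^ 2))
                        * (2 * liftMassC 4 L + 4 * CPLine 4 L (Fintype.card n) εc τ * liftCurlC 4 L)))
                * dirSq (chartDir (ContinuousLinearMap.id ℝ (Matrix n n ℂ)) N (v : TDir 4 n N)) (periodBox N) := by
  have hL1 : 1 ≤ L := le_trans (by norm_num) hL
  have hL0 : (0 : ℝ) < L := by exact_mod_cast (show 0 < L by omega)
  obtain ⟨ε₁, hε₁, T⟩ := effectiveForm_lower_bound_class (n := n) hL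
  have hc2 : 0 < c2' 4 L := c2'_pos 4 L hL1
  have hrate : 0 < ((L : ℝ) / (L : ℝ) ^ 4) / 2 := by positivity
  -- the seventeen ε-lines (and `ε ≤ ε₁`), each for all small `ε > 0`
  have e0 := eventually_nhdsGT_mul_le' (1 : ℝ) hε₁
  have e1 := eventually_nhdsGT_mul_le' (8 * radD 4 L * (((L : ℝ) ^ 2)⁻¹) ^ 2) one_pos
  have e2 := eventually_nhdsGT_mul_le' (4 * twoLevelSmall 4 L * ((L : ℝ) ^ 2)⁻¹) one_pos
  have e3 := eventually_nhdsGT_mul_le' (8 * (L : ℝ) * mC 4 L (Fintype.card n) * ((L : ℝ) ^ 2)⁻¹) one_pos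
  have e4 := eventually_nhdsGT_mul_le' (1 : ℝ) one_pos
  have e5 := eventually_nhdsGT_mul_le' (cruxC 4 L) (c := 1 / 2) (by norm_num)
  have e6 := eventually_nhdsGT_mul_le' (thetaLoc 4 L) (c := 1 / 2) (by norm_num)
  have e7 := eventually_nhdsGT_mul_le' (43584 : ℝ) (c := 1 / 2) (by norm_num)
  have e8 := eventually_nhdsGT_mul_le' (6 * C0 4) (c := 1 / 3) (by norm_num)
  have e9 := eventually_nhdsGT_mul_le' (24 : ℝ) hc2
  have e10 := eventually_nhdsGT_mul_le' (12 * (800 * (((4 : ℕ) : ℝ) + 1) ^ 2 * (((4 : ℕ) : ℝ) + 4))) (c := 1 / 4) (by norm_num)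
  have e11 := eventually_nhdsGT_mul_le' (4 * radD 4 L * (((L : ℝ) ^ 2)⁻¹) ^ 2) one_pos
  have e12 := eventually_nhdsGT_mul_le' ((16 * ((4 : ℝ) + 1) * ((4 : ℝ) + 4) * (L : ℝ) ^ 2 * Csup 4 L * (4 * (2 * (nbRad 4 L : ℝ) + 1) ^ 4)) * (8 / 3 * ((L : ℝ) ^ 2)⁻¹)) hrate
  have e13 := eventually_nhdsGT_mul_le' (1 : ℝ) hτ
  have e14 := eventually_nhdsGT_mul_le' (16 * (14464 * (((4 : ℕ) : ℝ) + 1) ^ 2 * (((4 : ℕ) : ℝ) + 4) ^ 2)) (c := 3) (by norm_num)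
  have e15 := eventually_nhdsGT_mul_le' (2 * twoLevelSmall 4 L) (c := (L : ℝ) ^ 2) (by positivity)
  have e16 := eventually_nhdsGT_mul_le' (28 * (Fintype.card (T4AveragingDeficitWall.Plane 4) : ℝ) * (4 * CPLine 4 L (Fintype.card n) εc τ * Fintype.card n)) one_pos
  have e17 := eventually_nhdsGT_mul_le'
    ((2 * curl1C 4 L * (128 * (C1cov 4 * (L : ℝ) ^ 2 * (4 * (4 * (L : ℝ) + 1) ^ 4)) * (L : ℝ) ^ 2)) * (2 * (4 * CPLine 4 L (Fintype.card n) εc τ * Fintype.card n))) one_pos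
  have hev : ∀ᶠ ε in 𝓝[>] (0 : ℝ), ∀ (N : ℕ) [NeZero N], 1 ≤ N → ∀ j : ℕ,
      ∃ δV : ℝ, 0 < δV ∧
        ∀ V₀ ∈ {V : Site 4 → Fin 4 → (Matrix n n ℂ)ˣ | IsUnitaryCfg V ∧ IsPeriodicCfg V (N : ℤ) ∧ SmallField V δV},
        ∀ Us : Site 4 → Fin 4 → (Matrix n n ℂ)ˣ, IsMinimiser 4 (sfClass 4 L N ε) L N (j + 1) V₀ Us → ∀ θ : ℝ, 0 < θ →
        ∀ v : ↥(skewSub 4 n N),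
          (1 - (2 * curl1C 4 L * ε * (128 * (C1cov 4 * (L : ℝ) ^ 2 * (4 * (4 * (L : ℝ) + 1) ^ 4)) * (L : ℝ) ^ 2)) * (2 * (4 * CPLine 4 L (Fintype.card n) εc τ * Fintype.card n)))
              * (((stepWt 4 L)⁻¹) ^ (j + 1) * ∑ P ∈ perWin 4 N, nhsNormSq (curl V₀ (chartDir (ContinuousLinearMap.id ℝ (Matrix n n ℂ)) N (v : TDir 4 n N)) P))
            ≤ ((1 + θ) + 2 * ((1 + θ) * (14 * (Fintype.card (T4AveragingDeficitWall.Plane 4) : ℝ) * ε) + (1 + θ⁻¹) * (36 * eC 4 L (Fintype.card n) ^ 2 * ε ^ 2))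
                    * (4 * CPLine 4 L (Fintype.card n) εc τ * Fintype.card n))
                * fderiv ℝ (fderiv ℝ (fun y : ↥(skewSub 4 n N) => minAct 4 (sfClass 4 L N ε) L N (j + 1) (chart (ContinuousLinearMap.id ℝ (Matrix n n ℂ)) N V₀ (y : TDir 4 n N)))) 0 v v
              + ((stepWt 4 L)⁻¹) ^ (j + 1)
                * (2 * (((1 + θ) + 2 * ((1 + θ) * (14 * (Fintype.card (T4AveragingDeficitWall.Plane 4) : ℝ) * ε) + (1 + θ⁻¹) * (36 * eC 4 L (Fintype.card n) ^ 2 * ε ^ 2))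
                        * (4 * CPLine 4 L (Fintype.card n) εc τ * Fintype.card n)))
                      * (2 * curl1C 4 L * ε * (128 * (C1cov 4 * (L : ℝ) ^ 2 * (4 * (4 * (L : ℝ) + 1) ^ 4)) * (L : ℝ) ^ 2)) * (2 * liftMassC 4 L + 4 * CPLine 4 L (Fintype.card n) εc τ * liftCurlC 4 L)
                    + (1 - (2 * curl1C 4 L * ε * (128 * (C1cov 4 * (L : ℝ) ^ 2 * (4 * (4 * (L : ℝ) + 1) ^ 4)) * (L : ℝ) ^ 2)) * (2 * (4 * CPLine 4 L (Fintype.card n) εc τ * Fintype.card n)))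
                      * (2 * ((1 + θ) * (14 * (Fintype.card (T4AveragingDeficitWall.Plane 4) : ℝ) * ε) + (1 + θ⁻¹) * (36 * eC 4 L (Fintype.card n) ^ 2 * ε ^ 2))
                        * (2 * liftMassC 4 L + 4 * CPLine 4 L (Fintype.card n) εc τ * liftCurlC 4 L)))
                * dirSq (chartDir (ContinuousLinearMap.id ℝ (Matrix n n ℂ)) N (v : TDir 4 n N)) (periodBox N) := by
    filter_upwards [self_mem_nhdsWithin, e0, e1, e2, e3, e4, e5, e6, e7, e8, e9, e10, e11, e12, e13, e14, e15, e16, e17]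
      with ε hε0 l0 l1 l2 l3 l4 l5 l6 l7 l8 l9 l10 l11 l12 l13 l14 l15 l16 l17
    have hε : 0 < ε := hε0
    -- the exponential line from `12·c·ε ≤ 1/4`
    have hx0 : 0 ≤ 4 * (800 * (((4 : ℕ) : ℝ) + 1) ^ 2 * (((4 : ℕ) : ℝ) + 4)) * (3 * ε) := by positivity
    have hx : 4 * (800 * (((4 : ℕ) : ℝ) + 1) ^ 2 * (((4 : ℕ) : ℝ) + 4)) * (3 * ε) ≤ 1 / 4 := by
      calc 4 * (800 * (((4 : ℕ) : ℝ) + 1) ^ 2 * (((4 : ℕ) : ℝ) + 4)) * (3 * ε) = ε * (12 * (800 * (((4 : ℕ) : ℝ) + 1) ^ 2 * (((4 : ℕ) : ℝ) + 4))) := by ring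
        _ ≤ 1 / 4 := l10
    have hroom : Real.exp (4 * (800 * (((4 : ℕ) : ℝ) + 1) ^ 2 * (((4 : ℕ) : ℝ) + 4)) * (3 * ε)) ≤ 3 / 2 := by
      set x : ℝ := 4 * (800 * (((4 : ℕ) : ℝ) + 1) ^ 2 * (((4 : ℕ) : ℝ) + 4)) * (3 * ε) with hxdef
      have h := Real.abs_exp_sub_one_le (x := x) (by rw [abs_of_nonneg hx0]; linarith)
      rw [abs_of_nonneg hx0] at h
      have h' := (abs_le.mp h).2
      linarith
    -- each line in the literal form of H16
    have m1 : 4 * (2 * ε) * radD 4 L * (((L : ℝ) ^ 2)⁻¹) ^ 2 ≤ 1 := by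
      calc 4 * (2 * ε) * radD 4 L * (((L : ℝ) ^ 2)⁻¹) ^ 2 = ε * (8 * radD 4 L * (((L : ℝ) ^ 2)⁻¹) ^ 2) := by ring
        _ ≤ 1 := l1
    have m2 : twoLevelSmall 4 L * (2 * (2 * ε) * ((L : ℝ) ^ 2)⁻¹) ≤ 1 := by
      calc twoLevelSmall 4 L * (2 * (2 * ε) * ((L : ℝ) ^ 2)⁻¹) = ε * (4 * twoLevelSmall 4 L * ((L : ℝ) ^ 2)⁻¹) := by ring
        _ ≤ 1 := l2
    have m3 : 8 * (L : ℝ) * mC 4 L (Fintype.card n) * ε * ((L : ℝ) ^ 2)⁻¹ ≤ 1 := by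
      calc 8 * (L : ℝ) * mC 4 L (Fintype.card n) * ε * ((L : ℝ) ^ 2)⁻¹ = ε * (8 * (L : ℝ) * mC 4 L (Fintype.card n) * ((L : ℝ) ^ 2)⁻¹) := by ring
        _ ≤ 1 := l3
    have m4 : ε ≤ 1 := by linarith
    have m5 : cruxC 4 L * ε < 1 := by linarith [mul_comm (cruxC 4 L) ε]
    have m6 : thetaLoc 4 L * ε ≤ 1 / 2 := by rw [mul_comm]; exact l6
    have m7 : 43584 * ε ≤ 1 / 2 := by linarith
    have m8 : C0 4 * (2 * (3 * ε)) ≤ 1 / 3 := by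
      calc C0 4 * (2 * (3 * ε)) = ε * (6 * C0 4) := by ring
        _ ≤ 1 / 3 := l8
    have m9 : 4 * (2 * (3 * ε)) ≤ c2' 4 L := by linarith
    have m11 : 4 * ε * radD 4 L * (((L : ℝ) ^ 2)⁻¹) ^ 2 ≤ 1 := by
      calc 4 * ε * radD 4 L * (((L : ℝ) ^ 2)⁻¹) ^ 2 = ε * (4 * radD 4 L * (((L : ℝ) ^ 2)⁻¹) ^ 2) := by ring
        _ ≤ 1 := l11
    have m12 : (16 * ((4 : ℝ) + 1) * ((4 : ℝ) + 4) * (L : ℝ) ^ 2 * Csup 4 L * (4 * (2 * (nbRad 4 L : ℝ) + 1) ^ 4)) * (8 / 3 * ε * ((L : ℝ) ^ 2)⁻¹)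
        ≤ ((L : ℝ) / (L : ℝ) ^ 4) / 2 := by
      calc (16 * ((4 : ℝ) + 1) * ((4 : ℝ) + 4) * (L : ℝ) ^ 2 * Csup 4 L * (4 * (2 * (nbRad 4 L : ℝ) + 1) ^ 4)) * (8 / 3 * ε * ((L : ℝ) ^ 2)⁻¹)
          = ε * ((16 * ((4 : ℝ) + 1) * ((4 : ℝ) + 4) * (L : ℝ) ^ 2 * Csup 4 L * (4 * (2 * (nbRad 4 L : ℝ) + 1) ^ 4)) * (8 / 3 * ((L : ℝ) ^ 2)⁻¹)) := by ring
        _ ≤ ((L : ℝ) / (L : ℝ) ^ 4) / 2 := l12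
    have m13 : ε ≤ τ := by linarith
    have m14 : 16 * (14464 * (((4 : ℕ) : ℝ) + 1) ^ 2 * (((4 : ℕ) : ℝ) + 4) ^ 2) * ε ≤ 3 := by rw [mul_comm]; exact l14
    have m15 : 2 * twoLevelSmall 4 L * ε ≤ (L : ℝ) ^ 2 := by rw [mul_comm]; exact l15
    have m16 : 28 * (Fintype.card (T4AveragingDeficitWall.Plane 4) : ℝ) * ε * (4 * CPLine 4 L (Fintype.card n) εc τ * Fintype.card n) ≤ 1 := by
      calc 28 * (Fintype.card (T4AveragingDeficitWall.Plane 4) : ℝ) * ε * (4 * CPLine 4 L (Fintype.card n) εc τ * Fintype.card n)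
          = ε * (28 * (Fintype.card (T4AveragingDeficitWall.Plane 4) : ℝ) * (4 * CPLine 4 L (Fintype.card n) εc τ * Fintype.card n)) := by ring
        _ ≤ 1 := l16
    have m17 : (2 * curl1C 4 L * ε * (128 * (C1cov 4 * (L : ℝ) ^ 2 * (4 * (4 * (L : ℝ) + 1) ^ 4)) * (L : ℝ) ^ 2)) * (2 * (4 * CPLine 4 L (Fintype.card n) εc τ * Fintype.card n)) ≤ 1 := by
      calc (2 * curl1C 4 L * ε * (128 * (C1cov 4 * (L : ℝ) ^ 2 * (4 * (4 * (L : ℝ) + 1) ^ 4)) * (L : ℝ) ^ 2)) * (2 * (4 * CPLine 4 L (Fintype.card n) εc τ * Fintype.card n))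
          = ε * ((2 * curl1C 4 L * (128 * (C1cov 4 * (L : ℝ) ^ 2 * (4 * (4 * (L : ℝ) + 1) ^ 4)) * (L : ℝ) ^ 2)) * (2 * (4 * CPLine 4 L (Fintype.card n) εc τ * Fintype.card n))) := by ring
        _ ≤ 1 := l17
    intro N _ hN j
    exact T ε hε (by linarith) m1 m2 m3 m4 m5 m6 m7 m8 m9 hroom m11 m12 τ εc m13 hεc m14 m15 h1 h2 h3 h4 m16 m17 N hN j
  obtain ⟨ε₀, hε₀, H⟩ := (nhdsGT_basis (0 : ℝ)).eventually_iff.mp hev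
  exact ⟨ε₀, hε₀, fun ε hε hεlt N _ hN j => H ⟨hε, hεlt⟩ N hN j⟩

end

end Summit.QuantumFields.BalabanUV.T4Continuum.NE7EffectiveFormLowerBoundFinal
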